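import Literature.Topology.FourManifolds.CappellShanesonEisensteinSeven
import Literature.NumberTheory.NumberFields.CubicFieldDedekindKummer
import HarnessLib

/-!
# Dedekind–Kummer for the Cappell–Shaneson cubics at the primes not dividing the conductor

Serves the Cappell–Shaneson / Gompf programme of this directory (M. H. Kim, S. Yamada, *Ideal
classes and Cappell–Shaneson homotopy 4-spheres*, Kyungpook Math. J. 63 (2023) 373–411; K. Iwaki,
Topology Appl. 366 (2025) 109293) at the traces `n` whose order `ℤ[Θₙ] = ℤ[x]/(fₙ)`,
`fₙ = x³ - nx² + (n-1)x - 1`, is NOT the maximal order of `K = ℚ(Θₙ)` — Kim–Yamada's family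
`n = 49k + 27` (§4.2, Prop. 4.10/4.11: `(Θₙ - 2)²/7` is an algebraic integer outside `ℤ[Θₙ]`), in
Iwaki's window `70 ≤ n ≤ 78` the single trace `n = 76` (§4.3, Table, row `n = 76`).  The per-trace
class-group files of the tree (`CappellShanesonClassGroup<N>*.lean`) obtain the primes of `𝓞 K`
from Dedekind's criterion under `𝓞 K = ℤ[θ]` (`…_of_sq`, `…_of_isUnit` in
`CappellShanesonClassNumberTwo.lean`, `CappellShanesonEisensteinSeven.lean`).  Here the same five
statements are proved under Mathlib's natural LOCAL hypothesis

  `¬ p ∣ RingOfIntegers.exponent (thetaInt hθ)`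

(`p` prime to the conductor of `ℤ[θ]`; for `ℤ[Θ₇₆]`, of index `7`, every `p ≠ 7` —
`CappellShanesonSeventysixIntegers.lean`), which is exactly what Marcus's form of the
Dedekind–Kummer theorem requires (D. A. Marcus, *Number Fields*, 2nd ed., Ch. 3, Thm. 27 and
Exercise 3.20: the factorisation of `p 𝓞 K` follows that of `f mod p` whenever `p ∤ [𝓞 K : ℤ[θ]]`):

* `exists_factor_of_mem_primesOver_of_not_dvd_exponent` — a prime `P` above `p` is `(p, Q(θ))` for an
  integer lift `Q` of the corresponding monic irreducible factor of `fₐ mod p`, of residue degree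
  `deg Q` (Mathlib `NumberField.Ideal.primesOverSpanEquivMonicFactorsMod`);
* `eq_span_of_no_root_of_not_dvd_exponent` — no root mod `p`: the prime above `p` is `(p)`;
* `eq_span_pair_of_unique_root_of_not_dvd_exponent` — a single simple root `c₀` and `p² > U ≥ p^f`:
  `P = (p, θ - c₀)`;
* `eq_span_pair_of_split_of_not_dvd_exponent` — `fₐ ≡ (x-c₁)(x-c₂)(x-c₃)`: `P = (p, θ - cᵢ)`;
* `eq_span_pair_of_linear_mul_quadratic_of_not_dvd_exponent` — `fₐ ≡ (x-c)·g`, `g` irreducible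
  quadratic: `P = (p, θ - c)` or `(p, g(θ))`;
* `not_dvd_exponent_of_mul_mem` — the hypothesis from `N · 𝓞 K ⊆ ℤ[θ]`, `p ∤ N`
  (`MonicCubic.not_dvd_exponent` transported along `csPoly_eq_poly`).

All proved (the proofs are those of the `_of_isUnit` family with the exponent hypothesis taken as
input); no definition, no named fact (D-0026).

## References

* [Marcus2018] D. A. Marcus, *Number Fields*, 2nd ed. (2018), Ch. 3, Thm. 27 (Dedekind–Kummer)
  and Exercises 3.20–3.22 (the conductor / index hypothesis).
* [KimYamada2023] M. H. Kim, S. Yamada, Kyungpook Math. J. 63 (2023) 373–411 (arXiv:1707.03860),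
  §4.2 Prop. 4.10–4.11 (the non-maximal traces `49k + 27`).
* [Iwaki2025] K. Iwaki, Topology Appl. 366 (2025) 109293 (arXiv:2404.05096), §4.3 (Table, row
  `n = 76`).
-/

noncomputable section

open Set Polynomial Module NumberField Ideal
open scoped NumberField nonZeroDivisors
open Literature.NumberTheory.NumberFields

namespace Literature.Topology.FourManifolds

section Root

variable {K : Type*} [Field K] [NumberField K] {a : ℤ} {θ : K}

/-- **`p ∤ exponent(θ)` from `N · 𝓞 K ⊆ ℤ[θ]` and `p ∤ N`** (Marcus, Ex. 3.20: `N` lies in the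
conductor, the exponent divides `N`), for a root `θ` of the Cappell–Shaneson cubic `fₐ`.
[cite: Marcus2018, Ch. 3, Exercise 20 and Thm. 27] -/
theorem not_dvd_exponent_of_mul_mem (hθ : aeval θ (csPoly a) = 0) {N : ℕ}
    (hN : ∀ x : 𝓞 K, (N : K) * x ∈ Algebra.adjoin ℤ ({θ} : Set K)) {p : ℕ} (hp : ¬ p ∣ N) :
    ¬ p ∣ RingOfIntegers.exponent (thetaInt hθ) :=
  MonicCubic.not_dvd_exponent (aeval_poly_of_aeval_csPoly hθ) hN hp

/-- **Dedekind–Kummer at `p ∤ exponent(θ)`**: a prime `P` of `𝓞 K` above `p` is `(p, Q(θ))` for any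
integer lift `Q` of the monic irreducible factor `Q̄` of `fₐ mod p` attached to `P`, and
`f(P|p) = deg Q̄`. [cite: Marcus2018, Ch. 3, Thm. 27] -/
theorem exists_factor_of_mem_primesOver_of_not_dvd_exponent (hθ : aeval θ (csPoly a) = 0)
    {p : ℕ} (hp : p.Prime) (hexp : ¬ p ∣ RingOfIntegers.exponent (thetaInt hθ))
    {P : Ideal (𝓞 K)} (hP : P ∈ primesOver (span {(p : ℤ)}) (𝓞 K)) :
    ∃ Qb : (ZMod p)[X], Irreducible Qb ∧ Qb.Monic ∧ Qb ∣ csPolyMod a p ∧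
      P.inertiaDeg ℤ = Qb.natDegree ∧
      ∀ Q : ℤ[X], Q.map (Int.castRingHom (ZMod p)) = Qb →
        P = span {(p : 𝓞 K), aeval (thetaInt hθ) Q} := by
  haveI := Fact.mk hp
  set e := NumberField.Ideal.primesOverSpanEquivMonicFactorsMod (K := K) hexp with he
  set Qb := e ⟨P, hP⟩ with hQb
  have hmem : (Qb : (ZMod p)[X]) ∈ RingOfIntegers.monicFactorsMod (thetaInt hθ) p := Qb.2
  have hmem' := hmem
  simp only [RingOfIntegers.monicFactorsMod, Multiset.mem_toFinset, minpoly_thetaInt hθ] at hmem'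
  have h0 : csPolyMod a p ≠ 0 := (monic_csPolyMod a p).ne_zero
  obtain ⟨hirr, hmon, hdvd⟩ := (Polynomial.mem_normalizedFactors_iff h0).mp hmem'
  refine ⟨Qb, hirr, hmon, hdvd, ?_, ?_⟩
  · have := NumberField.Ideal.inertiaDeg_primesOverSpanEquivMonicFactorsMod_symm_apply' hexp hmem
    rwa [show (⟨(Qb : (ZMod p)[X]), hmem⟩ : RingOfIntegers.monicFactorsMod (thetaInt hθ) p) = Qb
      from Subtype.ext rfl, Equiv.symm_apply_apply] at this
  · intro Q hQ
    have hmemQ : Q.map (Int.castRingHom (ZMod p)) ∈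
        RingOfIntegers.monicFactorsMod (thetaInt hθ) p := hQ ▸ hmem
    have h1 := NumberField.Ideal.primesOverSpanEquivMonicFactorsMod_symm_apply_eq_span hexp hmemQ
    have h2 : (⟨Q.map (Int.castRingHom (ZMod p)), hmemQ⟩ :
        RingOfIntegers.monicFactorsMod (thetaInt hθ) p) = Qb := Subtype.ext hQ
    rw [h2, hQb, Equiv.symm_apply_apply] at h1
    exact h1

/-- **Inert primes** (`p ∤ exponent(θ)`): if `fₐ` has no root modulo `p`, every prime above `p` is
`(p)`. [cite: Marcus2018, Ch. 3, Thm. 27] -/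
theorem eq_span_of_no_root_of_not_dvd_exponent (hθ : aeval θ (csPoly a) = 0)
    {p : ℕ} (hp : p.Prime) (hexp : ¬ p ∣ RingOfIntegers.exponent (thetaInt hθ))
    {P : Ideal (𝓞 K)} (hP : P ∈ primesOver (span {(p : ℤ)}) (𝓞 K))
    (hnr : ∀ c : ZMod p, c ^ 3 - (a : ZMod p) * c ^ 2 + ((a : ZMod p) - 1) * c - 1 ≠ 0) :
    P = span {(p : 𝓞 K)} := by
  haveI := Fact.mk hp
  obtain ⟨Qb, hirr, hmon, hdvd, -, hspan⟩ :=
    exists_factor_of_mem_primesOver_of_not_dvd_exponent hθ hp hexp hP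
  have hfirr : Irreducible (csPolyMod a p) := by
    refine irreducible_of_degree_le_three_of_not_isRoot
      (by rw [natDegree_csPolyMod]; decide) fun c hc => hnr c ?_
    rwa [IsRoot.def, eval_csPolyMod] at hc
  have hQb : Qb = csPolyMod a p :=
    eq_of_monic_of_associated hmon (monic_csPolyMod a p) (hirr.associated_of_dvd hfirr hdvd)
  have h := hspan (csPoly a) (by rw [hQb]; rfl)
  rw [aeval_thetaInt hθ] at h
  rw [h, Ideal.span_insert, Ideal.span_singleton_eq_bot.mpr rfl, sup_bot_eq]

/-- **Degree-one primes above a prime with a single simple root** (`p ∤ exponent(θ)`): if every root of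
`fₐ mod p` equals `c₀` and `p ^ f(P|p) ≤ U < p²`, then `P = (p, θ - c₀)`.
[cite: Marcus2018, Ch. 3, Thm. 27] -/
theorem eq_span_pair_of_unique_root_of_not_dvd_exponent (hθ : aeval θ (csPoly a) = 0)
    {p : ℕ} (hp : p.Prime) (hexp : ¬ p ∣ RingOfIntegers.exponent (thetaInt hθ))
    {P : Ideal (𝓞 K)} (hP : P ∈ primesOver (span {(p : ℤ)}) (𝓞 K)) {U : ℕ}
    (hle : p ^ P.inertiaDeg ℤ ≤ U) {c₀ : ℤ}
    (hroot : ∀ c : ZMod p, c ^ 3 - (a : ZMod p) * c ^ 2 + ((a : ZMod p) - 1) * c - 1 = 0 →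
      c = (c₀ : ZMod p))
    (hU : U < p ^ 2) :
    P = span {(p : 𝓞 K), thetaInt hθ - (c₀ : 𝓞 K)} := by
  haveI := Fact.mk hp
  obtain ⟨Qb, hirr, hmon, hdvd, hdeg, hspan⟩ :=
    exists_factor_of_mem_primesOver_of_not_dvd_exponent hθ hp hexp hP
  have hQb1 : Qb.natDegree = 1 := by
    have h1 : 1 ≤ Qb.natDegree := by
      rcases Nat.eq_zero_or_pos Qb.natDegree with h0 | h0
      · exact absurd (Polynomial.eq_one_of_monic_natDegree_zero hmon h0 ▸ isUnit_one)
          hirr.not_isUnit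
      · exact h0
    by_contra hne
    have h2 : 2 ≤ Qb.natDegree := by omega
    have : p ^ 2 ≤ p ^ P.inertiaDeg ℤ := Nat.pow_le_pow_right hp.pos (hdeg ▸ h2)
    omega
  have hQbeq : Qb = X + C (Qb.coeff 0) := hmon.eq_X_add_C hQb1
  have hc : -Qb.coeff 0 = (c₀ : ZMod p) := by
    apply hroot
    have hr : (csPolyMod a p).IsRoot (-Qb.coeff 0) := by
      rw [← dvd_iff_isRoot, map_neg, sub_neg_eq_add, ← hQbeq]
      exact hdvd
    rwa [IsRoot.def, eval_csPolyMod] at hr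
  have hQb' : (X - C c₀ : ℤ[X]).map (Int.castRingHom (ZMod p)) = Qb := by
    rw [Polynomial.map_sub, map_X, map_C, eq_intCast, ← hc, map_neg, sub_neg_eq_add, ← hQbeq]
  have hPeq := hspan (X - C c₀) hQb'
  simp only [map_sub, aeval_X, aeval_C, algebraMap_int_eq, Int.coe_castRingHom] at hPeq
  exact hPeq

/-- **Primes above a prime at which `fₐ` is a product of linear factors** (`p ∤ exponent(θ)`; the
roots need not be distinct). [cite: Marcus2018, Ch. 3, Thm. 27] -/
theorem eq_span_pair_of_split_of_not_dvd_exponent (hθ : aeval θ (csPoly a) = 0)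
    {p : ℕ} (hp : p.Prime) (hexp : ¬ p ∣ RingOfIntegers.exponent (thetaInt hθ))
    {c₁ c₂ c₃ : ℤ}
    (hfac : csPolyMod a p = (X - C (c₁ : ZMod p)) * (X - C (c₂ : ZMod p)) * (X - C (c₃ : ZMod p)))
    {P : Ideal (𝓞 K)} (hP : P ∈ primesOver (span {(p : ℤ)}) (𝓞 K)) :
    P = span {(p : 𝓞 K), thetaInt hθ - (c₁ : 𝓞 K)} ∨ P = span {(p : 𝓞 K), thetaInt hθ - (c₂ : 𝓞 K)} ∨
      P = span {(p : 𝓞 K), thetaInt hθ - (c₃ : 𝓞 K)} := by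
  haveI := Fact.mk hp
  obtain ⟨Qb, hirr, hmon, hdvd, -, hspan⟩ :=
    exists_factor_of_mem_primesOver_of_not_dvd_exponent hθ hp hexp hP
  rw [hfac] at hdvd
  have hlin : ∀ c : ℤ, Qb = X - C (c : ZMod p) → P = span {(p : 𝓞 K), thetaInt hθ - (c : 𝓞 K)} := by
    intro c hc
    have hQb' : (X - C c : ℤ[X]).map (Int.castRingHom (ZMod p)) = Qb := by
      rw [Polynomial.map_sub, map_X, map_C, eq_intCast, hc]
    have hPeq := hspan (X - C c) hQb'
    simp only [map_sub, aeval_X, aeval_C, algebraMap_int_eq, Int.coe_castRingHom] at hPeq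
    exact hPeq
  rcases eq_of_irreducible_of_dvd_linear_mul hirr hmon hdvd with h1 | h2 | h3'
  · exact Or.inl (hlin _ h1)
  · exact Or.inr (Or.inl (hlin _ h2))
  · exact Or.inr (Or.inr (hlin _ h3'))

/-- **Primes above `p` when `fₐ ≡ (x - c) g (mod p)` with `g` an irreducible quadratic**
(`p ∤ exponent(θ)`): `P = (p, θ - c)` or `P = (p, g(θ))`. [cite: Marcus2018, Ch. 3, Thm. 27] -/
theorem eq_span_pair_of_linear_mul_quadratic_of_not_dvd_exponent (hθ : aeval θ (csPoly a) = 0)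
    {p : ℕ} (hp : p.Prime) (hexp : ¬ p ∣ RingOfIntegers.exponent (thetaInt hθ))
    {c : ℤ} {G : ℤ[X]}
    (hGmon : (G.map (Int.castRingHom (ZMod p))).Monic)
    (hGirr : Irreducible (G.map (Int.castRingHom (ZMod p))))
    (hfac : csPolyMod a p = (X - C (c : ZMod p)) * G.map (Int.castRingHom (ZMod p)))
    {P : Ideal (𝓞 K)} (hP : P ∈ primesOver (span {(p : ℤ)}) (𝓞 K)) :
    P = span {(p : 𝓞 K), thetaInt hθ - (c : 𝓞 K)} ∨
      P = span {(p : 𝓞 K), aeval (thetaInt hθ) G} := by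
  haveI := Fact.mk hp
  obtain ⟨Qb, hirr, hmon, hdvd, -, hspan⟩ :=
    exists_factor_of_mem_primesOver_of_not_dvd_exponent hθ hp hexp hP
  rw [hfac] at hdvd
  rcases hirr.prime.dvd_or_dvd hdvd with hlin | hquad
  · left
    have hdeg1 : 1 ≤ Qb.natDegree := by
      rcases Nat.eq_zero_or_pos Qb.natDegree with h0 | h0
      · exact absurd (Polynomial.eq_one_of_monic_natDegree_zero hmon h0 ▸ isUnit_one) hirr.not_isUnit
      · exact h0
    have hQc : Qb = X - C (c : ZMod p) :=
      (Polynomial.eq_of_monic_of_dvd_of_natDegree_le hmon (monic_X_sub_C _) hlin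
        (by rw [natDegree_X_sub_C]; exact hdeg1)).symm
    have hQb' : (X - C c : ℤ[X]).map (Int.castRingHom (ZMod p)) = Qb := by
      rw [Polynomial.map_sub, map_X, map_C, eq_intCast, hQc]
    have hPeq := hspan (X - C c) hQb'
    simp only [map_sub, aeval_X, aeval_C, algebraMap_int_eq, Int.coe_castRingHom] at hPeq
    exact hPeq
  · right
    have hQG : Qb = G.map (Int.castRingHom (ZMod p)) :=
      eq_of_monic_of_associated hmon hGmon (hirr.associated_of_dvd hGirr hquad)
    exact hspan G hQG.symm

/-- **The residue degree of a degree-one prime** (`p ∤ exponent(θ)`): if `fₐ ≡ (x - c) g (mod p)` with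
`g` an irreducible quadratic and `P = (p, θ - c) ≠ (p, g(θ))`, then `p ^ f(P|p) = p`; stated as:
every prime above `p` has `p ^ f(P|p) = p` or `= p²`. [cite: Marcus2018, Ch. 3, Thm. 27] -/
theorem pow_inertiaDeg_eq_of_not_dvd_exponent (hθ : aeval θ (csPoly a) = 0)
    {p : ℕ} (hp : p.Prime) (hexp : ¬ p ∣ RingOfIntegers.exponent (thetaInt hθ))
    {P : Ideal (𝓞 K)} (hP : P ∈ primesOver (span {(p : ℤ)}) (𝓞 K)) :
    p ^ P.inertiaDeg ℤ = p ∨ p ^ P.inertiaDeg ℤ = p ^ 2 ∨ p ^ P.inertiaDeg ℤ = p ^ 3 := by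
  haveI := Fact.mk hp
  obtain ⟨Qb, hirr, hmon, hdvd, hdeg, -⟩ :=
    exists_factor_of_mem_primesOver_of_not_dvd_exponent hθ hp hexp hP
  have hle : Qb.natDegree ≤ 3 := by
    have := Polynomial.natDegree_le_of_dvd hdvd (monic_csPolyMod a p).ne_zero
    rwa [natDegree_csPolyMod] at this
  have h1 : 1 ≤ Qb.natDegree := by
    rcases Nat.eq_zero_or_pos Qb.natDegree with h0 | h0
    · exact absurd (Polynomial.eq_one_of_monic_natDegree_zero hmon h0 ▸ isUnit_one) hirr.not_isUnit
    · exact h0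
  rw [hdeg]
  interval_cases Qb.natDegree
  · exact Or.inl (pow_one p)
  · exact Or.inr (Or.inl rfl)
  · exact Or.inr (Or.inr rfl)

end Root

end Literature.Topology.FourManifolds

end
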